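import Summits.CriticalPhenomena.PercolationContinuityZ3.Theorems.PercAnnulusCrossingIICShapeUnion
import HarnessLib

/-!
# Two shapes linked to a far sphere, lower bound: Harris and the glued annulus `U(a, la)` (lane RSW3, p1 gen 26)

builds on p205010 (kernel theorem, internal audit signed; external expert review pending) — NOT used in this file (every `d`, `p`;
Harris–FKG, the robust glued annulus `CU⁺_l`, translation invariance).

RSW3 lane (LANE 3 `prim-rsw3`), seat `prim-rsw3-p1` (gen 26).  Helper file (`--supports stmt-CriticalPhenomena-4575`); no definitions,
no sorries.  Memo `run/shared/lean/prim/rsw3/P1-QM.md` §39.5.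

The converse of `…IICShapePairBound` / `…IICShapeUnion`: two shapes `T_i = x_i + S_i` (`S_i ⊆ Λ(m)`) both inside `Λ(a−1)`
(`‖x_i‖ + m ≤ a − 1`) and a far sphere `∂ⁱⁿΛ(ρ)`, `la ≤ ρ`.  On the glued annulus `U(a, la)` the link of `T₁` to `∂ⁱⁿΛ(ρ)` (a crossing of
`Λ(la) ∖ Λ(a−1)` from inside) and the link of `T₂` to `∂ⁱⁿΛ(la)` are joined (`…IICCapacityScales.setLink_of_setLink_of_link_of_annulusUniq`), so
`U(a,la) ∩ L(T₂, la) ∩ L₁ ⊆ L₁ ∩ L₂`; Harris for the two increasing events and `CU⁺_l` for the annulus: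
**`c_U · P(L(T₂, la)) · P(L₁) ≤ P(L₁ ∩ L₂)`** (`real_shapePair_ge`), and in the shapes' frames (`…IICShapeUnion.real_setLink_le_shapeLink`)
**`c_U · P(L(S₂, la + ‖x₂‖ + 1)) · P(L(S₁, ρ + ‖x₁‖ + 1)) ≤ P(L₁ ∩ L₂)`** (`real_shapePair_ge_setLink`) — with `…IICCapacityScales` both factors
are capacities times one-arm probabilities: TWO SHAPES AT MUTUAL SCALE `a` ARE LINKED TO A FAR SPHERE TOGETHER WITH PROBABILITY
`≳ Cap(S₁)·Cap(S₂)·π(la)·π(ρ)`, matching the upper bound `≲ Cap₁Cap₂π(r)π(ρ)` of `…IICShapeUnion` when `a ≍ r = ‖x₂ − x₁‖`.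
References: T. E. Harris, Proc. Camb. Phil. Soc. 56 (1960) Lemma 4.1; H. Kesten, PTRF 73 (1986) §2; G. Grimmett, *Percolation* (1999) §2.2.
-/

noncomputable section

namespace Summit.CriticalPhenomena.PercolationContinuityZ3.Theorems.Crossing

open MeasureTheory Filter Topology Literature.Probability.Percolation Literature.Probability.LatticeModels
open Literature.Probability.Percolation.DCT16
open Summit.CriticalPhenomena.PercolationContinuityZ3.Theorems.SurfaceTension

variable {d : ℕ}

/-- The shape-to-sphere event `{∃ q ∈ X, ∃ t ∈ ∂ⁱⁿΛ(r), q ↔ t in Λ(r)}` is increasing. [folklore] -/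
private theorem isUpperSet_link_box' (X : Finset (Site d)) (r : ℕ) :
    IsUpperSet {ω : BondConfig (Site d) | ∃ q ∈ X, ∃ t ∈ innerBoundary (zdGraph d) (box d r),
      ω ∈ openConnIn (↑(box d r) : Set (Site d)) q t} := by
  intro ω ω' hle h
  obtain ⟨q, hq, t, ht, hqt⟩ := h
  exact ⟨q, hq, t, ht, isUpperSet_openConnIn _ q t hle hqt⟩

open Classical in
/-- **TWO SHAPES LINKED TO A FAR SPHERE, LOWER BOUND** (every `d`, `p`; `CU⁺_l(c_U)`, `l ≥ 2`, `c_U ≥ 0`; `S_i ⊆ Λ(m)`,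
`‖x_i‖ + m + 1 ≤ a`, `la ≤ ρ`; `T_i = x_i + S_i`, `L_i = {T_i ↔ ∂ⁱⁿΛ(ρ) in Λ(ρ)}`):
**`c_U · P(T₂ ↔ ∂ⁱⁿΛ(la) in Λ(la)) · P(L₁) ≤ P(L₁ ∩ L₂)`** — Harris for the two increasing events; on `U(a,la)` the link of `T₁` (a crossing
of the annulus from `Λ(a−1)`) re-routes the link of `T₂` to `∂ⁱⁿΛ(ρ)`. [cite: Harris1960, Lemma 4.1] [cite: Kesten1986, §2] -/
theorem real_shapePair_ge (p : unitInterval) {l : ℕ} (hl : 2 ≤ l) {cU : ℝ} (hcU : 0 ≤ cU)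
    (hCU : ∀ a : ℕ, 1 ≤ a → ∀ E : Set (BondConfig (Site d)), IsUpperSet E → MeasurableSet E →
      cU * (bondPercolation (zdGraph d) p).real E ≤ (bondPercolation (zdGraph d) p).real (E ∩
        {ω : BondConfig (Site d) | ∀ t ∈ innerBoundary (zdGraph d) (box d a), ∀ s ∈ innerBoundary (zdGraph d) (box d (l * a)),
        ∀ t' ∈ innerBoundary (zdGraph d) (box d a), ∀ s' ∈ innerBoundary (zdGraph d) (box d (l * a)),
        ω ∈ openConnIn (↑((box d (l * a) \ box d a) ∪ innerBoundary (zdGraph d) (box d a)) : Set (Site d)) t s →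
        ω ∈ openConnIn (↑((box d (l * a) \ box d a) ∪ innerBoundary (zdGraph d) (box d a)) : Set (Site d)) t' s' →
        ω ∈ openConnIn (↑((box d (l * a) \ box d a) ∪ innerBoundary (zdGraph d) (box d a)) : Set (Site d)) s s'}))
    {S₁ S₂ : Finset (Site d)} {x₁ x₂ : Site d} {m a ρ : ℕ} (hS₁ : S₁ ⊆ box d m) (hS₂ : S₂ ⊆ box d m)
    (hx₁ : Site.supNorm x₁ + m + 1 ≤ a) (hx₂ : Site.supNorm x₂ + m + 1 ≤ a) (hρ : l * a ≤ ρ) :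
    cU * (bondPercolation (zdGraph d) p).real {ω : BondConfig (Site d) | ∃ q ∈ S₂.image (· + x₂),
          ∃ t ∈ innerBoundary (zdGraph d) (box d (l * a)), ω ∈ openConnIn (↑(box d (l * a)) : Set (Site d)) q t} *
        (bondPercolation (zdGraph d) p).real {ω : BondConfig (Site d) | ∃ q ∈ S₁.image (· + x₁),
          ∃ t ∈ innerBoundary (zdGraph d) (box d ρ), ω ∈ openConnIn (↑(box d ρ) : Set (Site d)) q t} ≤
      (bondPercolation (zdGraph d) p).real
        ({ω : BondConfig (Site d) | ∃ q ∈ S₁.image (· + x₁), ∃ t ∈ innerBoundary (zdGraph d) (box d ρ),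
            ω ∈ openConnIn (↑(box d ρ) : Set (Site d)) q t} ∩
          {ω | ∃ q ∈ S₂.image (· + x₂), ∃ t ∈ innerBoundary (zdGraph d) (box d ρ), ω ∈ openConnIn (↑(box d ρ) : Set (Site d)) q t}) := by
  classical
  set μ := bondPercolation (zdGraph d) p with hμ
  have ha : 1 ≤ a := by omega
  set A : Set (BondConfig (Site d)) := {ω : BondConfig (Site d) | ∃ q ∈ S₂.image (· + x₂),
    ∃ t ∈ innerBoundary (zdGraph d) (box d (l * a)), ω ∈ openConnIn (↑(box d (l * a)) : Set (Site d)) q t} with hA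
  set L₁ : Set (BondConfig (Site d)) := {ω : BondConfig (Site d) | ∃ q ∈ S₁.image (· + x₁),
    ∃ t ∈ innerBoundary (zdGraph d) (box d ρ), ω ∈ openConnIn (↑(box d ρ) : Set (Site d)) q t} with hL₁
  set L₂ : Set (BondConfig (Site d)) := {ω : BondConfig (Site d) | ∃ q ∈ S₂.image (· + x₂),
    ∃ t ∈ innerBoundary (zdGraph d) (box d ρ), ω ∈ openConnIn (↑(box d ρ) : Set (Site d)) q t} with hL₂
  have hAu : IsUpperSet A := isUpperSet_link_box' _ _
  have hL₁u : IsUpperSet L₁ := isUpperSet_link_box' _ _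
  have hAm : MeasurableSet A :=
    (determinedBy_link_sym2 (box d (l * a)) (S₂.image (· + x₂)) (innerBoundary (zdGraph d) (box d (l * a)))).measurableSet_of_finset
  have hL₁m : MeasurableSet L₁ :=
    (determinedBy_link_sym2 (box d ρ) (S₁.image (· + x₁)) (innerBoundary (zdGraph d) (box d ρ))).measurableSet_of_finset
  -- the shapes lie in `Λ(a−1)`
  have hT₁ : S₁.image (· + x₁) ⊆ box d (a - 1) := by
    intro q hq
    rw [mem_image_add_iff_sub_mem] at hq
    have h1 := mem_box_iff_supNorm_le.1 (hS₁ hq)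
    have h2 := Site.supNorm_add_le (q - x₁) x₁
    rw [sub_add_cancel] at h2
    exact mem_box_iff_supNorm_le.2 (by omega)
  have hT₂ : S₂.image (· + x₂) ⊆ box d (a - 1) := by
    intro q hq
    rw [mem_image_add_iff_sub_mem] at hq
    have h1 := mem_box_iff_supNorm_le.1 (hS₂ hq)
    have h2 := Site.supNorm_add_le (q - x₂) x₂
    rw [sub_add_cancel] at h2
    exact mem_box_iff_supNorm_le.2 (by omega)
  -- Harris, then the glued annulus
  have hH : μ.real A * μ.real L₁ ≤ μ.real (A ∩ L₁) := harris_fkg_holds (zdGraph d) p hAu hL₁u hAm hL₁m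
  have hCUF := hCU a ha (A ∩ L₁) (hAu.inter hL₁u) (hAm.inter hL₁m)
  have hglue : μ.real ((A ∩ L₁) ∩ {ω : BondConfig (Site d) | ∀ t ∈ innerBoundary (zdGraph d) (box d a),
        ∀ s ∈ innerBoundary (zdGraph d) (box d (l * a)), ∀ t' ∈ innerBoundary (zdGraph d) (box d a), ∀ s' ∈ innerBoundary (zdGraph d) (box d (l * a)),
        ω ∈ openConnIn (↑((box d (l * a) \ box d a) ∪ innerBoundary (zdGraph d) (box d a)) : Set (Site d)) t s →
        ω ∈ openConnIn (↑((box d (l * a) \ box d a) ∪ innerBoundary (zdGraph d) (box d a)) : Set (Site d)) t' s' →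
        ω ∈ openConnIn (↑((box d (l * a) \ box d a) ∪ innerBoundary (zdGraph d) (box d a)) : Set (Site d)) s s'}) ≤ μ.real (L₁ ∩ L₂) := by
    refine real_mono_of_forall_subset_edgeSet (zdGraph d) p fun ω hω h => ?_
    obtain ⟨⟨hωA, hωL₁⟩, hωU⟩ := h
    refine ⟨hωL₁, ?_⟩
    obtain ⟨q₁, hq₁, t₁, ht₁, h₁⟩ := hωL₁
    exact setLink_of_setLink_of_link_of_annulusUniq ha hl hρ (S₂.image (· + x₂)) hT₂ hω hωU hωA ⟨q₁, hT₁ hq₁, t₁, ht₁, h₁⟩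
  calc cU * μ.real A * μ.real L₁ = cU * (μ.real A * μ.real L₁) := by ring
    _ ≤ cU * μ.real (A ∩ L₁) := mul_le_mul_of_nonneg_left hH hcU
    _ ≤ _ := hCUF
    _ ≤ _ := hglue

open Classical in
/-- **TWO SHAPES LINKED TO A FAR SPHERE, LOWER BOUND IN THE SHAPES' FRAMES** (every `d`, `p`; `CU⁺_l(c_U)`; `S_i ⊆ Λ(m)`,
`‖x_i‖ + m + 1 ≤ a`, `la ≤ ρ`):
**`c_U · P(L(S₂, la + ‖x₂‖ + 1)) · P(L(S₁, ρ + ‖x₁‖ + 1)) ≤ P(L₁ ∩ L₂)`** — with `…IICCapacityScales` the left side is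
`≳ Cap(S₁)·Cap(S₂)·π(la)·π(ρ)`. [cite: Harris1960, Lemma 4.1] [cite: Kesten1986, §2] -/
theorem real_shapePair_ge_setLink (p : unitInterval) {l : ℕ} (hl : 2 ≤ l) {cU : ℝ} (hcU : 0 ≤ cU)
    (hCU : ∀ a : ℕ, 1 ≤ a → ∀ E : Set (BondConfig (Site d)), IsUpperSet E → MeasurableSet E →
      cU * (bondPercolation (zdGraph d) p).real E ≤ (bondPercolation (zdGraph d) p).real (E ∩
        {ω : BondConfig (Site d) | ∀ t ∈ innerBoundary (zdGraph d) (box d a), ∀ s ∈ innerBoundary (zdGraph d) (box d (l * a)),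
        ∀ t' ∈ innerBoundary (zdGraph d) (box d a), ∀ s' ∈ innerBoundary (zdGraph d) (box d (l * a)),
        ω ∈ openConnIn (↑((box d (l * a) \ box d a) ∪ innerBoundary (zdGraph d) (box d a)) : Set (Site d)) t s →
        ω ∈ openConnIn (↑((box d (l * a) \ box d a) ∪ innerBoundary (zdGraph d) (box d a)) : Set (Site d)) t' s' →
        ω ∈ openConnIn (↑((box d (l * a) \ box d a) ∪ innerBoundary (zdGraph d) (box d a)) : Set (Site d)) s s'}))
    {S₁ S₂ : Finset (Site d)} {x₁ x₂ : Site d} {m a ρ : ℕ} (hS₁ : S₁ ⊆ box d m) (hS₂ : S₂ ⊆ box d m)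
    (hx₁ : Site.supNorm x₁ + m + 1 ≤ a) (hx₂ : Site.supNorm x₂ + m + 1 ≤ a) (hρ : l * a ≤ ρ) :
    cU * (bondPercolation (zdGraph d) p).real {ω : BondConfig (Site d) | ∃ q ∈ S₂,
          ∃ t ∈ innerBoundary (zdGraph d) (box d (l * a + Site.supNorm x₂ + 1)),
            ω ∈ openConnIn (↑(box d (l * a + Site.supNorm x₂ + 1)) : Set (Site d)) q t} *
        (bondPercolation (zdGraph d) p).real {ω : BondConfig (Site d) | ∃ q ∈ S₁,
          ∃ t ∈ innerBoundary (zdGraph d) (box d (ρ + Site.supNorm x₁ + 1)),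
            ω ∈ openConnIn (↑(box d (ρ + Site.supNorm x₁ + 1)) : Set (Site d)) q t} ≤
      (bondPercolation (zdGraph d) p).real
        ({ω : BondConfig (Site d) | ∃ q ∈ S₁.image (· + x₁), ∃ t ∈ innerBoundary (zdGraph d) (box d ρ),
            ω ∈ openConnIn (↑(box d ρ) : Set (Site d)) q t} ∩
          {ω | ∃ q ∈ S₂.image (· + x₂), ∃ t ∈ innerBoundary (zdGraph d) (box d ρ), ω ∈ openConnIn (↑(box d ρ) : Set (Site d)) q t}) := by
  have hl1 : 1 ≤ l := by omega
  have h2 := real_setLink_le_shapeLink p hS₂ (x := x₂) (ρ := l * a) (by nlinarith)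
  have h1 := real_setLink_le_shapeLink p hS₁ (x := x₁) (ρ := ρ) (by nlinarith)
  refine le_trans ?_ (real_shapePair_ge p hl hcU hCU hS₁ hS₂ hx₁ hx₂ hρ)
  exact mul_le_mul (mul_le_mul_of_nonneg_left h2 hcU) h1 measureReal_nonneg (mul_nonneg hcU measureReal_nonneg)

end Summit.CriticalPhenomena.PercolationContinuityZ3.Theorems.Crossing

end
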